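import Summits.Ventures.CertifiedManyBodySolver.Certificates.HubbardSquare_tpm3o10_U29o5_toyKernelCert_energyRow
import HarnessLib

/-!
# STEP-0 of «tier P», capstone toy: a window certificate with ALL families populated (51 SOS factors, 8 translation moves, two density
# rows, the mean-energy objective) replayed in the kernel — the kinematic ENERGY FLOOR `e₀(1, −3/10, 29/5; x) ≥ −(26/5)·x` at every
# density `x ∈ [0, 2)` of the `t–t'` Hubbard model at the La214-E station, ZERO hypotheses, NO claim node

HONEST FRAMING: a TOY of CONTROL/CALIBRATION class — `−(26/5)x = −(4t + 4|t′|)·x` is the trivial one-body (band-edge) floor, far below the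
cell's certified windows (`≈ −0.64…−0.86` at `x = 1`); the point is the CERTIFICATE SHAPE an exporter must produce, here written by hand and
checked by the kernel: objective = the embedded mean-energy observable `E_Φ = U n_{0↑}n_{0↓} − ½Σ_{NN}hop + (3/20)Σ_{diag}hop`
(`energyTermsIdx`, dictionary `termOp_energyTermsIdx`); Gram part = 51 SOS factors — per NN bond `b = (0, v)` and spin two copies of
`½(a_{0σ} − a_{vσ})` (`½(n₀ + n_v − hop_b) ⪰ 0`), per diagonal bond four copies `r(a_{0σ} + a_{vσ})`, `r ∈ {3/10, 1/5, 1/10, 1/10}` (`Σr² = 3/20`: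
`(3/20)(n₀ + n_v + hop_b) ⪰ 0`), and three copies `r·a_{0↓}a_{0↑}`, `r ∈ {2, 6/5, 3/5}` (`Σr² = 29/5 = U`: `U n_{0↑}n_{0↓} ⪰ 0`); symmetry
family = the 8 licensed translations `0 ↦ v` of the inner words `−c_v (n_{0↑} + n_{0↓})` (`c_v = ½` NN, `3/20` diagonal), turning every
`n_{vσ}` into `n_{0σ}`; density rows `μ_↑ = μ_↓ = −26/5`. The residual normal-orders to `0` (`decide +kernel`), so
`affineOrbitLowerRowN_of_kernelCert` gives the affine-N row `−26/5 − (26/5)(x − 1) ≤ Re ω(Γ E_Φ)`, and `toy_energy_row` (the kernel-replayed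
identity `Re ω(Γ E_Φ) = e₀`) turns it into the floor on `energyDensityTT'` (non-vacuity of the state class:
`exists_isTorusLimitOf_sectorGroundState_TT'`). Trust base: the Lean kernel (std axioms). No number of record; no existing claim node
discharged; silent on ρ_s = 0 / presence / T_c / phase; nothing about La₂CuO₄; no summit statement is proved by this file. Seat
hubbard-obs-p2 (STIFFNESS), `prover-hubbard-obs-p2-g22-0`, zero compute.

References: J. Wang et al., PRX 14 (2024) 031006 §III [WangEtAl2024]; X. Han, arXiv:2006.06002 §3 [Han2020Bootstrap].
-/

noncomputable section

namespace Summit.Ventures.CertifiedManyBodySolver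

namespace CARPolyWindow

namespace Toy3x3

open Summit.Ventures.CertifiedQuantumChemistry Summit.Ventures.CertifiedQuantumChemistry.CARPoly
open Literature.MathematicalPhysics.QuantumLattice Literature.MathematicalPhysics.QuantumLattice.HubbardWave0
open Literature.MathematicalPhysics.QuantumManyBody.StateRelaxation
open Literature.Probability.LatticeModels ThermodynamicLimit Filter Topology
open Matrix
open scoped ComplexOrder BigOperators

/-! ## The certificate data -/

/-- NN bond factors: two copies of `½(a_{0σ} − a_{kσ})` for `k = 1…4`, both spins. [folklore] -/
def QnnF : List (Terms (Orb (Fin 9))) :=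
  (finL 4).flatMap fun k => (finL 2).flatMap fun σ => (finL 2).map fun _ =>
    [([(orb 0 σ, false)], (1 / 2 : ℚ)), ([(orb (⟨k.val + 1, by omega⟩ : Fin 9) σ, false)], -(1 / 2 : ℚ))]

/-- Diagonal bond factors: `r(a_{0σ} + a_{kσ})`, `r ∈ {3/10, 1/5, 1/10, 1/10}`, for `k = 5…8`, both spins. [folklore] -/
def QdgF : List (Terms (Orb (Fin 9))) :=
  (finL 4).flatMap fun k => (finL 2).flatMap fun σ =>
    [(3 / 10 : ℚ), 1 / 5, 1 / 10, 1 / 10].map fun r =>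
      [([(orb 0 σ, false)], r), ([(orb (⟨k.val + 5, by omega⟩ : Fin 9) σ, false)], r)]

/-- On-site factors: `r·a_{0↓}a_{0↑}`, `r ∈ {2, 6/5, 3/5}` (`Σ r² = 29/5`). [folklore] -/
def QuF : List (Terms (Orb (Fin 9))) :=
  [(2 : ℚ), 6 / 5, 3 / 5].map fun r => [([(orb 0 1, false), (orb 0 0, false)], r)]

/-- All 51 SOS factors. [folklore] -/
def Qe : List (Terms (Orb (Fin 9))) := QnnF ++ QdgF ++ QuF

/-- The density multipliers `μ_↑ = μ_↓ = −26/5`. [folklore] -/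
def mue (_σ : Fin 2) : ℚ := -26 / 5

/-- The inner words moved by the 8 translations `0 ↦ xs (l+1)`: `−c_l (n_{0↑} + n_{0↓})`, `c = ½` (NN, `l < 4`), `3/20` (diagonal). [folklore] -/
def SYe (l : Fin 8) : Terms (Fin 2) :=
  [([((0 : Fin 2), true), ((0 : Fin 2), false)], if l.val < 4 then -(1 / 2 : ℚ) else -(3 / 20 : ℚ)),
    ([((1 : Fin 2), true), ((1 : Fin 2), false)], if l.val < 4 then -(1 / 2 : ℚ) else -(3 / 20 : ℚ))]

/-- The moves on letters: spin `σ` at the origin ↦ index letter `(l+1, σ)`. [folklore] -/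
def ge (l : Fin 8) (σ : Fin 2) : Orb (Fin 9) := orb l.succ σ

/-- The residual of the energy-floor certificate (objective `TE`, density rows, 51 factors, 8 moves; no energy rows, no eom, no charged /
anti-Hermitian families). [cite: WangEtAl2024, §III] -/
def floorResid : Terms (Orb (Fin 9)) :=
  residT TE mue 0 (fun σ => orb 0 σ) 0 0 0 0 TE 0 Qe TH fb [] ge SYe [] []

/-- **The kernel evaluation**: `−26/5 ≤ lowerConst (normalize floorResid) + (μ_↑ + μ_↓)(n₀/2 − 0)` at `n₀ = 1` (the residual normal-orders
to `0`; decided by the kernel). [cite: WangEtAl2024, §III] -/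
theorem floor_lowerConst : (-26 / 5 : ℚ) ≤ lowerConst (CARPoly.normalize enc 32 floorResid) + (mue 0 + mue 1) * ((1 : ℚ) / 2 - 0) := by
  decide +kernel

/-! ## The end-to-end theorems -/

/-- Membership-proof irrelevance for ordered sites. [folklore] -/
private theorem pt_congr_site₅ {x y : Site 2} (hx : x ∈ W) (hy : y ∈ W) (h : x = y) :
    PolySite.pt x hx = PolySite.pt y hy := by
  subst h; rfl

/-- A translate `{0} + v` of the inner window by a window site lies in `W`. [folklore] -/
theorem shift_singleton_subset_W {v : Site 2} (hv : v ∈ W) : d4ShiftSet 1 v ({0} : Finset (Site 2)) ⊆ W := by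
  intro x hx
  rw [d4ShiftSet, Finset.mem_map] at hx
  obtain ⟨y, hy, rfl⟩ := hx
  rw [Finset.mem_singleton] at hy
  subst hy
  show d4Vec 1 0 + v ∈ W
  rw [d4Vec_one, zero_add]
  exact hv

/-- **The affine-N row of the energy-floor certificate**: `SquareTTPrimeCorrAffineOrbitLowerRowN (−3/10) (29/5) (−26/5) 0 0 0 0 (−26/5) 1 {1} W
(termOp d TE)` — ZERO hypotheses. [cite: WangEtAl2024, §III] -/
theorem floor_affineOrbitLowerRowN :
    SquareTTPrimeCorrAffineOrbitLowerRowN (((-3 / 10 : ℚ)) : ℝ) (((29 / 5 : ℚ)) : ℝ) (-26 / 5) 0 0 0 0 (-26 / 5) 1 {1} W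
      (termOp d TE) := by
  have hz : (0 : Site 2) ∈ W := zero_mem_thicken_zero 1
  have h1 : (1 : DihedralGroup 4) ∈ ({1} : Finset (DihedralGroup 4)) := Finset.mem_singleton_self 1
  have hmul : ∀ a ∈ ({1} : Finset (DihedralGroup 4)), ∀ b ∈ ({1} : Finset (DihedralGroup 4)),
      a * b ∈ ({1} : Finset (DihedralGroup 4)) := by
    intro a ha b hb
    rw [Finset.mem_singleton] at ha hb ⊢
    rw [ha, hb, mul_one]
  have hΛ : ({0} : Finset (Site 2)) ⊆ W := Finset.singleton_subset_iff.2 hz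
  have hx0 : xs 0 = 0 := xs_zero
  have ho : ∀ σ : Fin 2, d (orb 0 σ) = orb (PolySite.pt 0 hz) σ := by
    intro σ
    rw [d_orb, pt_congr_site₅ (xs_mem 0) hz hx0]
  have hf : ∀ σ : Fin 2, d (fb σ) = Orb.embMap (PolySite.incl hΛ) (dΛb σ) := by
    intro σ
    rw [fb, d_orb, pt_congr_site₅ (xs_mem 0) (hΛ (Finset.mem_singleton_self 0)) hx0]
    rfl
  have hsh : ∀ l : Fin 8, d4ShiftSet ((fun _ : Fin 8 => (1 : DihedralGroup 4)) l) ((fun l : Fin 8 => xs l.succ) l)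
      ({0} : Finset (Site 2)) ⊆ W := fun l => shift_singleton_subset_W (xs_mem l.succ)
  have hg : ∀ (l : Fin 8) (σ : Fin 2), d (ge l σ) = Orb.embMap (PolySite.incl (hsh l))
      (Orb.embMap (PolySite.d4Emb ((fun _ : Fin 8 => (1 : DihedralGroup 4)) l) ((fun l : Fin 8 => xs l.succ) l)
        ({0} : Finset (Site 2))) (dΛb σ)) := by
    intro l σ
    have hxl : xs l.succ = d4Vec 1 0 + xs l.succ := by rw [d4Vec_one, zero_add]
    rw [ge, d_orb, pt_congr_site₅ (xs_mem l.succ)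
      (shift_singleton_subset_W (xs_mem l.succ) (d4Vec_add_mem_d4ShiftSet 1 (xs l.succ) (Finset.mem_singleton_self 0))) hxl]
    rfl
  have hH : termOp d TH = (hubbardTTPrimeFermionInteraction 1 (((-3 / 10 : ℚ)) : ℝ) (((29 / 5 : ℚ)) : ℝ)).localHamiltonian W := by
    rw [TH, termOp_hamTermsIdx 1 (-3 / 10) (29 / 5) xs xs_mem xs_injective xs_cover d d_orb, Rat.cast_one]
  have hE : termOp d TE = fermionEmbed (PolySite.incl (subset_refl W))
      ((hubbardTTPrimeFermionInteraction 1 (((-3 / 10 : ℚ)) : ℝ) (((29 / 5 : ℚ)) : ℝ)).meanEnergyObs 1) := by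
    rw [TE, termOp_energyTermsIdx 1 (-3 / 10) (29 / 5) xs xs_mem (subset_refl W) ix xs_ix_of_mem d d_orb, Rat.cast_one]
  exact affineOrbitLowerRowN_of_kernelCert (-3 / 10) (29 / 5) (by norm_num) hΛ (subset_refl W) (subset_refl W) hz h1 hmul
    d d_injective enc 32 dΛb fb hf (fun p => (ofLex p).2) (fun _ => rfl) TH hH TE hE (fun σ => orb 0 σ) ho TE mue 0 0 0 0
    0 0 Qe [] (fun _ : Fin 8 => (1 : DihedralGroup 4)) (fun _ => h1) (fun l : Fin 8 => xs l.succ) hsh ge hg SYe []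
    (fun wc hwc => absurd hwc (List.not_mem_nil)) [] (by norm_num [mue]) floor_lowerConst

/-- **THE KINEMATIC ENERGY FLOOR, KERNEL-REPLAYED**: for every density `x ∈ [0, 2)`,
`−(26/5)·x ≤ energyDensityTT' 1 (−3/10) (29/5) x` — the 51-factor / 8-move / two-density-row certificate through the whole pipeline, the
identity `Re ω(Γ E_Φ) = e₀` from `toy_energy_row`, and non-vacuity of the torus-limit ground-state class. (CONTROL class: the trivial
band-edge floor; no number of record.) [cite: WangEtAl2024, §III] -/
theorem toy_energy_floor (x : ℝ) (hx0 : 0 ≤ x) (hx2 : x < 2) :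
    -(26 / 5) * x ≤ energyDensityTT' 1 (((-3 / 10 : ℚ)) : ℝ) (((29 / 5 : ℚ)) : ℝ) x := by
  obtain ⟨ψ, φ, ω, hφ, hψ, hψ1, hω, -, -, -⟩ :=
    exists_isTorusLimitOf_sectorGroundState_TT' 1 (((-3 / 10 : ℚ)) : ℝ) (((29 / 5 : ℚ)) : ℝ) hx0 hx2.le
      (Ls := id) tendsto_id
  have hLs : Tendsto (id ∘ φ) atTop atTop := tendsto_id.comp hφ.tendsto_atTop
  have hrow := floor_affineOrbitLowerRowN x hx0 hx2 ω (id ∘ φ) ψ hLs (fun j => hψ _) (fun j => hψ1 _) hω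
  have hid := toy_energy_row x hx0 hx2 ω (id ∘ φ) ψ hLs (fun j => hψ _) (fun j => hψ1 _) hω
  have hE : termOp d TE = fermionEmbed (PolySite.incl (subset_refl W))
      ((hubbardTTPrimeFermionInteraction 1 (((-3 / 10 : ℚ)) : ℝ) (((29 / 5 : ℚ)) : ℝ)).meanEnergyObs 1) := by
    rw [TE, termOp_energyTermsIdx 1 (-3 / 10) (29 / 5) xs xs_mem (subset_refl W) ix xs_ix_of_mem d d_orb, Rat.cast_one]
  rw [Finset.sum_singleton, Finset.card_singleton, Nat.cast_one, inv_one, one_mul, ω.expect_fermionEmbed_d4Emb_one_zero, hE, hid]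
    at hrow
  push_cast at hrow
  linarith

end Toy3x3

end CARPolyWindow

end Summit.Ventures.CertifiedManyBodySolver

end
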